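import Mathlib
import Summits.NavierStokesRegularity.NavierStokesRegularity.Theorems.EulerZoomLiouvillePowerGaugeEulerLiouvilleCasimirHaulHaulingSlices
import HarnessLib

/-!
# Crux `EulerZoomLiouville.PowerGaugeEulerLiouville` (stmt-NavierStokesRegularity-19832), sub-line `casimir_haul`:
# THE HAULING INEQUALITY (line stub H3 `stub_haulingInequality`, `δ`-unfolded)

Route №10 `EulerZoomLiouville` (NavierStokesRegularity), crux E = stmt-NavierStokesRegularity-19832; width seat ns-ezl-w2 g7 under the LEAD ns-typeII-p2.

`haulingInequality`: there is an absolute constant `C` such that for `b ≥ 1`, `v ∈ C¹(ℝ³; ℝ³)`, `|w| ≤ 1` measurable and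
`A ⊆ {r < 2b, |x₂| < b}` measurable, with `M_A = ∫_A r²`,
`|∫_A w(x₂) v₂| ≤ C ‖Dv‖_{L²(cyl)} (M_A (1 + log b + log⁺(b/M_A)))^{1/2} + C (M_A/b²)^{1/2} ‖v‖_{L²(cyl)}`.
This is VERBATIM the line's `HaulingInequality` with `solidCyl`, `axisMoment` `δ`-unfolded, so the line filler is
`theorem stub_haulingInequality : Sig.stub_haulingInequality := fun _ => Theorems.PowerGaugeEulerLiouville.CasimirHaul.haulingInequality`
(the hypothesis `LogPoincareSmallSets` of the stub is not even needed: H2 is a theorem of the tree, `logPoincare_smallSets`, and enters through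
`abs_setIntegral_le_slice`).
Proof: slice along `x₂` (`setIntegral_w_mul_eq_integral_slices`), the planar small-set estimate in every slice
(`enorm_setIntegral_slice_le`), Cauchy–Schwarz in the axial variable (`ENNReal.lintegral_mul_le_Lp_mul_Lq`), the planar bathtub bound
`∫_t |A_t|² ≤ 2π M_A` (`lintegral_sq_volume_sliceSet_le`) and the concavity bookkeeping `integral_sq_mul_log_le'`; the degenerate case
`M_A = 0` is `A_t` null for a.e. `t`. [folklore assembly of the landed bricks]

WHAT THIS IS NOT: not NS, not E — H3 is one stub of the line `casimir_haul` of the OPEN crux class 19832 (`--supports`).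
-/

noncomputable section

-- flat `Theorems/<Route><Decl>…` files of one crux share the namespace of the crux (tree convention)
set_option linter.dupNamespace false

open MeasureTheory Set Filter Function WithLp Metric Real
open scoped ENNReal Topology

namespace Summit.NavierStokesRegularity.NavierStokesRegularity.Theorems.PowerGaugeEulerLiouville.CasimirHaul

open Literature.Analysis.FluidPDE Literature.Analysis.FunctionSpaces

section Main

/-- **The hauling inequality** (line `casimir_haul`, stub H3 `stub_haulingInequality`, `δ`-unfolded: `solidCyl b =
{r < 2b, |x₂| < b}`, `axisMoment A = ∫_A r²`). There is an absolute constant `C > 0` such that for all `b ≥ 1`,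
`v ∈ C¹(ℝ³;ℝ³)`, measurable `w` with `|w| ≤ 1`, and measurable `A ⊆ solidCyl b`,
`|∫_A w(x₂) v₂| ≤ C ‖Dv‖_{L²(solidCyl b)} (M_A (1 + log b + log⁺(b/M_A)))^{1/2} + C (M_A/b²)^{1/2} ‖v‖_{L²(solidCyl b)}`,
`M_A = ∫_A r²`. Proof: slicing along the axis, the planar small-set estimate (log-Poincaré, H2) in every slice,
Cauchy–Schwarz in the axial variable, the planar bathtub bound and the concavity bookkeeping. [folklore] -/
theorem haulingInequality :
    ∃ C : ℝ, 0 < C ∧ ∀ b : ℝ, 1 ≤ b → ∀ v : (EuclideanSpace ℝ (Fin 3)) → (EuclideanSpace ℝ (Fin 3)), ContDiff ℝ 1 v →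
      ∀ w : ℝ → ℝ, Measurable w → (∀ z : ℝ, |w z| ≤ 1) →
        ∀ A : Set (EuclideanSpace ℝ (Fin 3)), MeasurableSet A → A ⊆ {x : (EuclideanSpace ℝ (Fin 3)) | cylRadius x < 2 * b ∧ |x 2| < b} →
          |∫ x in A, w (x 2) * (v x) 2| ≤
            C * Real.sqrt (∫ x in {x : (EuclideanSpace ℝ (Fin 3)) | cylRadius x < 2 * b ∧ |x 2| < b}, ‖fderiv ℝ v x‖ ^ 2) *
                Real.sqrt ((∫ x in A, cylRadius x ^ 2) *
                  (1 + Real.log b + max 0 (Real.log (b / ∫ x in A, cylRadius x ^ 2)))) +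
              C * Real.sqrt ((∫ x in A, cylRadius x ^ 2) / b ^ 2) *
                Real.sqrt (∫ x in {x : (EuclideanSpace ℝ (Fin 3)) | cylRadius x < 2 * b ∧ |x 2| < b}, ‖v x‖ ^ 2) := by
  obtain ⟨C₂, hC₂, hsl⟩ := abs_setIntegral_le_slice
  refine ⟨max (Real.sqrt (32 * C₂)) 1, lt_max_of_lt_right one_pos, ?_⟩
  intro b hb v hv w hw hw1 A hA hAcyl
  have hb0 : 0 < b := by linarith
  have hA1 : ∀ x ∈ A, cylRadius x < 2 * b := fun x hx => (hAcyl hx).1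
  have hA2 : ∀ x ∈ A, |x 2| < b := fun x hx => (hAcyl hx).2
  have hcyl : MeasurableSet {x : (EuclideanSpace ℝ (Fin 3)) | cylRadius x < 2 * b ∧ |x 2| < b} :=
    (measurableSet_lt continuous_cylRadius.measurable measurable_const).inter
      (measurableSet_lt (continuous_abs.comp (PiLp.continuous_apply 2 (fun _ : Fin 3 => ℝ) 2)).measurable
        measurable_const)
  ---- the three real quantities and the log factor
  obtain ⟨M, hM⟩ : ∃ M : ℝ, M = ∫ x in A, cylRadius x ^ 2 := ⟨_, rfl⟩
  obtain ⟨D, hD⟩ : ∃ D : ℝ, D = ∫ x in {x : (EuclideanSpace ℝ (Fin 3)) | cylRadius x < 2 * b ∧ |x 2| < b}, ‖fderiv ℝ v x‖ ^ 2 :=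
    ⟨_, rfl⟩
  obtain ⟨V, hV⟩ : ∃ V : ℝ, V = ∫ x in {x : (EuclideanSpace ℝ (Fin 3)) | cylRadius x < 2 * b ∧ |x 2| < b}, ‖v x‖ ^ 2 := ⟨_, rfl⟩
  rw [← hM, ← hD, ← hV]
  have hM0 : 0 ≤ M := hM ▸ setIntegral_nonneg hA fun x _ => sq_nonneg _
  have hD0 : 0 ≤ D := hD ▸ setIntegral_nonneg hcyl fun x _ => sq_nonneg _
  have hV0 : 0 ≤ V := hV ▸ setIntegral_nonneg hcyl fun x _ => sq_nonneg _
  obtain ⟨K, hK⟩ : ∃ K : ℝ, K = 1 + Real.log b + max 0 (Real.log (b / M)) := ⟨_, rfl⟩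
  rw [← hK]
  have hK1 : 1 ≤ K := by
    rw [hK]
    linarith [Real.log_nonneg hb, le_max_left 0 (Real.log (b / M))]
  have hRHS : 0 ≤ max (Real.sqrt (32 * C₂)) 1 * Real.sqrt D * Real.sqrt (M * K) +
      max (Real.sqrt (32 * C₂)) 1 * Real.sqrt (M / b ^ 2) * Real.sqrt V := by positivity
  ---- the slices `A_t` and the sliced integrals `I t`
  obtain ⟨At, hAt⟩ : ∃ At : ℝ → Set (EuclideanSpace ℝ (Fin 2)), ∀ t, At t = {y : (EuclideanSpace ℝ (Fin 2)) | (toLp 2 ![y 0, y 1, t] : (EuclideanSpace ℝ (Fin 3))) ∈ A} :=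
    ⟨_, fun _ => rfl⟩
  have hAtm : ∀ t, MeasurableSet (At t) := fun t => by
    rw [hAt]
    exact measurableSet_sliceSet hA t
  have hAtB : ∀ t, At t ⊆ ball (0 : (EuclideanSpace ℝ (Fin 2))) (2 * b) := fun t => by
    rw [hAt]
    exact sliceSet_subset_ball hA1 t
  have hAtfin : ∀ t, volume (At t) ≠ ⊤ := fun t => ((measure_mono (hAtB t)).trans_lt measure_ball_lt_top).ne
  have hvolm : Measurable fun t => volume (At t) := by
    rw [show (fun t => volume (At t)) = fun t => volume {y : (EuclideanSpace ℝ (Fin 2)) | (toLp 2 ![y 0, y 1, t] : (EuclideanSpace ℝ (Fin 3))) ∈ A} from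
      funext fun t => by rw [hAt]]
    exact measurable_volume_sliceSet hA
  obtain ⟨I, hI⟩ : ∃ I : ℝ → ℝ, ∀ t, I t = ∫ y in At t, (v (toLp 2 ![y 0, y 1, t])) 2 := ⟨_, fun _ => rfl⟩
  -- Step 1: slicing
  have hLHS : ∫ x in A, w (x 2) * (v x) 2 = ∫ t, w t * I t := by
    rw [setIntegral_w_mul_eq_integral_slices hv.continuous hw hw1 hA hAcyl]
    refine integral_congr_ae (ae_of_all _ fun t => ?_)
    beta_reduce
    rw [hI, hAt]
  -- Step 2: `‖LHS‖ ≤ ∫_{(-b,b)} ‖I t‖`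
  have hI0 : ∀ t, t ∉ Ioo (-b) b → I t = 0 := by
    intro t ht
    have hbt : b ≤ |t| := by
      by_contra h
      push Not at h
      exact ht ⟨by linarith [neg_abs_le t], by linarith [le_abs_self t]⟩
    rw [hI, hAt, sliceSet_eq_empty_of_le hA2 hbt, Measure.restrict_empty, integral_zero_measure]
  have h2 : ‖∫ x in A, w (x 2) * (v x) 2‖ₑ ≤ ∫⁻ t in Ioo (-b) b, ‖I t‖ₑ := by
    rw [hLHS]
    refine (enorm_integral_le_lintegral_enorm _).trans ?_
    rw [← lintegral_indicator measurableSet_Ioo]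
    refine lintegral_mono fun t => ?_
    by_cases ht : t ∈ Ioo (-b) b
    · rw [indicator_of_mem ht, enorm_mul]
      calc ‖w t‖ₑ * ‖I t‖ₑ ≤ 1 * ‖I t‖ₑ := by
            gcongr
            rw [Real.enorm_eq_ofReal_abs]
            exact ENNReal.ofReal_le_one.2 (hw1 t)
        _ = ‖I t‖ₑ := one_mul _
    · rw [indicator_of_notMem ht, hI0 t ht, mul_zero, enorm_zero]
  ---- the `L²` slice quantities and the log factor
  obtain ⟨𝒩, h𝒩⟩ : ∃ 𝒩 : ℝ → ℝ≥0∞, ∀ t, 𝒩 t =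
      ∫⁻ y in ball (0 : (EuclideanSpace ℝ (Fin 2))) (2 * b), ‖v (toLp 2 ![y 0, y 1, t])‖ₑ ^ 2 := ⟨_, fun _ => rfl⟩
  obtain ⟨𝒥, h𝒥⟩ : ∃ 𝒥 : ℝ → ℝ≥0∞, ∀ t, 𝒥 t =
      ∫⁻ y in ball (0 : (EuclideanSpace ℝ (Fin 2))) (2 * b), ‖fderiv ℝ v (toLp 2 ![y 0, y 1, t])‖ₑ ^ 2 := ⟨_, fun _ => rfl⟩
  have h𝒩m : Measurable 𝒩 := by
    rw [show 𝒩 = fun t => ∫⁻ y in ball (0 : (EuclideanSpace ℝ (Fin 2))) (2 * b), ‖v (toLp 2 ![y 0, y 1, t])‖ₑ ^ 2 from funext h𝒩]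
    exact measurable_lintegral_ball_slice (hv.continuous.measurable.enorm.pow_const 2) (2 * b)
  have h𝒥m : Measurable 𝒥 := by
    rw [show 𝒥 = fun t => ∫⁻ y in ball (0 : (EuclideanSpace ℝ (Fin 2))) (2 * b), ‖fderiv ℝ v (toLp 2 ![y 0, y 1, t])‖ₑ ^ 2 from
      funext h𝒥]
    exact measurable_lintegral_ball_slice ((hv.continuous_fderiv one_ne_zero).measurable.enorm.pow_const 2) (2 * b)
  obtain ⟨ℒ, hℒ⟩ : ∃ ℒ : ℝ → ℝ≥0∞, ∀ t, ℒ t =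
      ENNReal.ofReal (Real.sqrt (1 + Real.log (4 * π * b ^ 2 / (volume (At t)).toReal))) := ⟨_, fun _ => rfl⟩
  have hℒm : Measurable ℒ := by
    rw [show ℒ = fun t => ENNReal.ofReal (Real.sqrt (1 + Real.log (4 * π * b ^ 2 / (volume (At t)).toReal))) from
      funext hℒ]
    exact ENNReal.measurable_ofReal.comp (Real.continuous_sqrt.measurable.comp
      ((Real.measurable_log.comp (hvolm.ennreal_toReal.const_div _)).const_add _))
  obtain ⟨c₁, hc₁⟩ : ∃ c₁ : ℝ≥0∞, c₁ = ENNReal.ofReal ((Real.sqrt (4 * π * b ^ 2))⁻¹) := ⟨_, rfl⟩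
  obtain ⟨c₂, hc₂⟩ : ∃ c₂ : ℝ≥0∞, c₂ = ENNReal.ofReal (Real.sqrt C₂) := ⟨_, rfl⟩
  -- Step 3: the per-slice estimate, integrated
  have h3 : ∀ t, ‖I t‖ₑ ≤ c₁ * (volume (At t) * 𝒩 t ^ (1 / 2 : ℝ)) +
      c₂ * ((volume (At t) * ℒ t) * 𝒥 t ^ (1 / 2 : ℝ)) := by
    intro t
    rw [hI, h𝒩, h𝒥, hℒ, hc₁, hc₂]
    exact enorm_setIntegral_slice_le hC₂ hsl hb0 hv t (hAtm t) (hAtB t)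
  have h3' : ∫⁻ t in Ioo (-b) b, ‖I t‖ₑ ≤
      c₁ * (∫⁻ t in Ioo (-b) b, volume (At t) * 𝒩 t ^ (1 / 2 : ℝ)) +
        c₂ * (∫⁻ t in Ioo (-b) b, (volume (At t) * ℒ t) * 𝒥 t ^ (1 / 2 : ℝ)) := by
    calc ∫⁻ t in Ioo (-b) b, ‖I t‖ₑ
        ≤ ∫⁻ t in Ioo (-b) b, (c₁ * (volume (At t) * 𝒩 t ^ (1 / 2 : ℝ)) +
            c₂ * ((volume (At t) * ℒ t) * 𝒥 t ^ (1 / 2 : ℝ))) := lintegral_mono fun t => h3 t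
      _ = _ := by
        have hm2 : Measurable fun t => volume (At t) * 𝒩 t ^ (1 / 2 : ℝ) := hvolm.mul (h𝒩m.pow_const _)
        have hm1 : Measurable fun t => c₁ * (volume (At t) * 𝒩 t ^ (1 / 2 : ℝ)) := measurable_const.mul hm2
        have hm3 : Measurable fun t => (volume (At t) * ℒ t) * 𝒥 t ^ (1 / 2 : ℝ) :=
          (hvolm.mul hℒm).mul (h𝒥m.pow_const _)
        rw [lintegral_add_left hm1, lintegral_const_mul c₁ hm2, lintegral_const_mul c₂ hm3]
  -- Step 4: Cauchy–Schwarz in the axial variable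
  have hCS1 : ∫⁻ t in Ioo (-b) b, volume (At t) * 𝒩 t ^ (1 / 2 : ℝ) ≤
      (∫⁻ t in Ioo (-b) b, volume (At t) ^ 2) ^ (1 / 2 : ℝ) * (∫⁻ t in Ioo (-b) b, 𝒩 t) ^ (1 / 2 : ℝ) := by
    have h := ENNReal.lintegral_mul_le_Lp_mul_Lq (volume.restrict (Ioo (-b) b)) Real.HolderConjugate.two_two
      hvolm.aemeasurable (h𝒩m.pow_const (1 / 2 : ℝ)).aemeasurable
    have e : ∀ t, (𝒩 t ^ (1 / 2 : ℝ)) ^ (2 : ℝ) = 𝒩 t := fun t => by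
      rw [← ENNReal.rpow_mul]
      norm_num
    simp only [Pi.mul_apply] at h
    simp only [e] at h
    simp only [ENNReal.rpow_two] at h
    exact h
  have hCS2 : ∫⁻ t in Ioo (-b) b, (volume (At t) * ℒ t) * 𝒥 t ^ (1 / 2 : ℝ) ≤
      (∫⁻ t in Ioo (-b) b, (volume (At t) * ℒ t) ^ 2) ^ (1 / 2 : ℝ) *
        (∫⁻ t in Ioo (-b) b, 𝒥 t) ^ (1 / 2 : ℝ) := by
    have h := ENNReal.lintegral_mul_le_Lp_mul_Lq (volume.restrict (Ioo (-b) b)) Real.HolderConjugate.two_two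
      (hvolm.mul hℒm).aemeasurable (h𝒥m.pow_const (1 / 2 : ℝ)).aemeasurable
    have e : ∀ t, (𝒥 t ^ (1 / 2 : ℝ)) ^ (2 : ℝ) = 𝒥 t := fun t => by
      rw [← ENNReal.rpow_mul]
      norm_num
    simp only [Pi.mul_apply] at h
    simp only [e] at h
    simp only [ENNReal.rpow_two] at h
    exact h
  -- Step 5: the four axial integrals
  have hr2i : IntegrableOn (fun x : (EuclideanSpace ℝ (Fin 3)) => cylRadius x ^ 2) A volume :=
    integrableOn_of_subset_solidCyl (continuous_cylRadius.pow 2) hAcyl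
  have hMlin : ∫⁻ x in A, ENNReal.ofReal (cylRadius x ^ 2) = ENNReal.ofReal M := by
    rw [hM, ofReal_integral_eq_lintegral_ofReal hr2i (ae_of_all _ fun x => sq_nonneg _)]
  have h6i0 : ∫⁻ t, volume (At t) ^ 2 ≤ ENNReal.ofReal (2 * π * M) := by
    calc ∫⁻ t, volume (At t) ^ 2
        = ∫⁻ t, volume {y : (EuclideanSpace ℝ (Fin 2)) | (toLp 2 ![y 0, y 1, t] : (EuclideanSpace ℝ (Fin 3))) ∈ A} ^ 2 := by simp_rw [hAt]
      _ ≤ ENNReal.ofReal (2 * π) * ∫⁻ x in A, ENNReal.ofReal (cylRadius x ^ 2) :=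
          lintegral_sq_volume_sliceSet_le hA hA1
      _ = ENNReal.ofReal (2 * π * M) := by rw [hMlin, ← ENNReal.ofReal_mul (by positivity)]
  have h6i : ∫⁻ t in Ioo (-b) b, volume (At t) ^ 2 ≤ ENNReal.ofReal (2 * π * M) :=
    (setLIntegral_le_lintegral _ _).trans h6i0
  have h6ii : ∫⁻ t in Ioo (-b) b, 𝒩 t = ENNReal.ofReal V := by
    have hvi : IntegrableOn (fun x : (EuclideanSpace ℝ (Fin 3)) => ‖v x‖ ^ 2) {x : (EuclideanSpace ℝ (Fin 3)) | cylRadius x < 2 * b ∧ |x 2| < b} volume :=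
      integrableOn_of_subset_solidCyl (hv.continuous.norm.pow 2) Subset.rfl
    calc ∫⁻ t in Ioo (-b) b, 𝒩 t
        = ∫⁻ t in Ioo (-b) b, ∫⁻ y in ball (0 : (EuclideanSpace ℝ (Fin 2))) (2 * b), ‖v (toLp 2 ![y 0, y 1, t])‖ₑ ^ 2 := by simp_rw [h𝒩]
      _ = ∫⁻ x in {x : (EuclideanSpace ℝ (Fin 3)) | cylRadius x < 2 * b ∧ |x 2| < b}, ‖v x‖ₑ ^ 2 :=
          (lintegral_solidCyl_eq_slices (hv.continuous.measurable.enorm.pow_const 2)).symm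
      _ = ∫⁻ x in {x : (EuclideanSpace ℝ (Fin 3)) | cylRadius x < 2 * b ∧ |x 2| < b}, ENNReal.ofReal (‖v x‖ ^ 2) := by
          refine lintegral_congr fun x => ?_
          rw [← ofReal_norm, ← ENNReal.ofReal_pow (norm_nonneg _)]
      _ = ENNReal.ofReal V := by rw [hV, ofReal_integral_eq_lintegral_ofReal hvi (ae_of_all _ fun x => sq_nonneg _)]
  have h6iii : ∫⁻ t in Ioo (-b) b, 𝒥 t = ENNReal.ofReal D := by
    have hDi : IntegrableOn (fun x : (EuclideanSpace ℝ (Fin 3)) => ‖fderiv ℝ v x‖ ^ 2) {x : (EuclideanSpace ℝ (Fin 3)) | cylRadius x < 2 * b ∧ |x 2| < b} volume :=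
      integrableOn_of_subset_solidCyl ((hv.continuous_fderiv one_ne_zero).norm.pow 2) Subset.rfl
    calc ∫⁻ t in Ioo (-b) b, 𝒥 t
        = ∫⁻ t in Ioo (-b) b, ∫⁻ y in ball (0 : (EuclideanSpace ℝ (Fin 2))) (2 * b), ‖fderiv ℝ v (toLp 2 ![y 0, y 1, t])‖ₑ ^ 2 := by
          simp_rw [h𝒥]
      _ = ∫⁻ x in {x : (EuclideanSpace ℝ (Fin 3)) | cylRadius x < 2 * b ∧ |x 2| < b}, ‖fderiv ℝ v x‖ₑ ^ 2 :=
          (lintegral_solidCyl_eq_slices ((hv.continuous_fderiv one_ne_zero).measurable.enorm.pow_const 2)).symm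
      _ = ∫⁻ x in {x : (EuclideanSpace ℝ (Fin 3)) | cylRadius x < 2 * b ∧ |x 2| < b}, ENNReal.ofReal (‖fderiv ℝ v x‖ ^ 2) := by
          refine lintegral_congr fun x => ?_
          rw [← ofReal_norm, ← ENNReal.ofReal_pow (norm_nonneg _)]
      _ = ENNReal.ofReal D := by rw [hD, ofReal_integral_eq_lintegral_ofReal hDi (ae_of_all _ fun x => sq_nonneg _)]
  ---- the degenerate case `M = 0`: almost every slice is null
  rcases hM0.eq_or_lt with hM00 | hMpos
  · have hz : ∫⁻ t, volume (At t) ^ 2 = 0 := by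
      refine le_antisymm ?_ bot_le
      calc ∫⁻ t, volume (At t) ^ 2 ≤ ENNReal.ofReal (2 * π * M) := h6i0
        _ = 0 := by rw [← hM00, mul_zero, ENNReal.ofReal_zero]
    have hae : ∀ᵐ t : ℝ, volume (At t) = 0 := by
      have h := (lintegral_eq_zero_iff' (hvolm.pow_const 2).aemeasurable).1 hz
      filter_upwards [h] with t ht
      simpa using ht
    have hI0' : ∀ᵐ t : ℝ, w t * I t = 0 := by
      filter_upwards [hae] with t ht
      rw [hI, Measure.restrict_eq_zero.2 ht, integral_zero_measure, mul_zero]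
    rw [hLHS, integral_eq_zero_of_ae hI0', abs_zero]
    exact hRHS
  ---- the main case `M > 0`
  -- the moment function and the hypotheses of the concavity bookkeeping
  obtain ⟨m, hm⟩ : ∃ m : ℝ → ℝ, ∀ t, m t = ∫ y in At t, ‖y‖ ^ 2 := ⟨_, fun _ => rfl⟩
  have hmom := moment_slices hA hAcyl
  have hm_fun : m = fun t => ∫ y in {y : (EuclideanSpace ℝ (Fin 2)) | (toLp 2 ![y 0, y 1, t] : (EuclideanSpace ℝ (Fin 3))) ∈ A}, ‖y‖ ^ 2 :=
    funext fun t => by rw [hm, hAt]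
  have hmi : IntegrableOn m (Ioo (-b) b) volume := by
    rw [hm_fun]
    exact hmom.1.integrableOn
  have hmM : ∫ t in Ioo (-b) b, m t = M := by rw [hm_fun, hmom.2, hM]
  have hm0 : ∀ t, 0 ≤ m t := fun t => by
    rw [hm]
    exact setIntegral_nonneg (hAtm t) fun y _ => sq_nonneg _
  have ha0 : ∀ t, 0 ≤ (volume (At t)).toReal := fun t => ENNReal.toReal_nonneg
  have haY : ∀ t, (volume (At t)).toReal ≤ 4 * π * b ^ 2 := fun t => by
    have h1 : (volume (At t)).toReal ≤ (volume (ball (0 : (EuclideanSpace ℝ (Fin 2))) (2 * b))).toReal :=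
      ENNReal.toReal_mono measure_ball_lt_top.ne (measure_mono (hAtB t))
    rw [volume_ball_fin_two_ofReal (by positivity) (0 : (EuclideanSpace ℝ (Fin 2))), ENNReal.toReal_ofReal (by positivity)] at h1
    linarith
  have ham : ∀ t, (volume (At t)).toReal ^ 2 ≤ 2 * π * m t := fun t => by
    have hint : IntegrableOn (fun z : (EuclideanSpace ℝ (Fin 2)) => ‖z - 0‖ ^ 2) (At t) volume :=
      (((continuous_norm.comp (continuous_id.sub continuous_const)).pow 2).continuousOn.integrableOn_compact
        (isCompact_closedBall (0 : (EuclideanSpace ℝ (Fin 2))) (2 * b))).mono_set ((hAtB t).trans ball_subset_closedBall)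
    have h := sq_volume_real_le_integral_norm_sq (hAtm t) (hAtfin t) 0 hint
    simp only [sub_zero] at h
    rw [hm]
    exact h
  have hL0 : ∀ t, 0 ≤ 1 + Real.log (4 * π * b ^ 2 / (volume (At t)).toReal) := fun t =>
    one_add_log_div_nonneg (ha0 t) (haY t)
  -- the log-moment integral
  have h6iv : ∫⁻ t in Ioo (-b) b, (volume (At t) * ℒ t) ^ 2 = ENNReal.ofReal
      (∫ t in Ioo (-b) b, (volume (At t)).toReal ^ 2 * (1 + Real.log (4 * π * b ^ 2 / (volume (At t)).toReal))) := by
    have hpt : ∀ t, (volume (At t) * ℒ t) ^ 2 =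
        ENNReal.ofReal ((volume (At t)).toReal ^ 2 * (1 + Real.log (4 * π * b ^ 2 / (volume (At t)).toReal))) := by
      intro t
      have hLt := hL0 t
      rw [hℒ]
      obtain ⟨a, ha⟩ : ∃ a : ℝ, a = (volume (At t)).toReal := ⟨_, rfl⟩
      have haS : volume (At t) = ENNReal.ofReal a := by rw [ha, ENNReal.ofReal_toReal (hAtfin t)]
      rw [← ha] at hLt ⊢
      rw [haS, ← ENNReal.ofReal_mul (ha ▸ ha0 t), ← ENNReal.ofReal_pow (mul_nonneg (ha ▸ ha0 t) (Real.sqrt_nonneg _)),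
        mul_pow, Real.sq_sqrt hLt]
    have hFi : IntegrableOn (fun t => (volume (At t)).toReal ^ 2 *
        (1 + Real.log (4 * π * b ^ 2 / (volume (At t)).toReal))) (Ioo (-b) b) volume := by
      refine Measure.integrableOn_of_bounded (M := (4 * π * b ^ 2) ^ 2) measure_Ioo_lt_top.ne ?_ ?_
      · exact ((hvolm.ennreal_toReal.pow_const 2).mul
          ((Real.measurable_log.comp (hvolm.ennreal_toReal.const_div _)).const_add 1)).aestronglyMeasurable
      · refine ae_of_all _ fun t => ?_
        rw [Real.norm_eq_abs, abs_of_nonneg (mul_nonneg (sq_nonneg _) (hL0 t))]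
        have hY : 0 < 4 * π * b ^ 2 := by positivity
        have h := monotoneOn_sq_mul_one_add_log hY ⟨ha0 t, haY t⟩ ⟨hY.le, le_rfl⟩ (haY t)
        simp only [div_self hY.ne', Real.log_one, add_zero, mul_one] at h
        exact h
    rw [lintegral_congr fun t => hpt t,
      ← ofReal_integral_eq_lintegral_ofReal hFi (ae_of_all _ fun t => mul_nonneg (sq_nonneg _) (hL0 t))]
  have h6iv' : ∫⁻ t in Ioo (-b) b, (volume (At t) * ℒ t) ^ 2 ≤ ENNReal.ofReal (32 * M * K) := by
    rw [h6iv]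
    refine ENNReal.ofReal_le_ofReal ?_
    have h := integral_sq_mul_log_le' hb (a := fun t => (volume (At t)).toReal) (m := m)
      (fun z _ => ha0 z) (fun z _ => haY z) (fun z _ => hm0 z) (fun z _ => ham z) hmi (hmM.symm ▸ hMpos)
    rw [hmM, ← hK] at h
    exact h
  ---- combination in `ℝ≥0∞` and conversion to `ℝ`
  have hfin : ‖∫ x in A, w (x 2) * (v x) 2‖ₑ ≤
      c₁ * ((ENNReal.ofReal (2 * π * M)) ^ (1 / 2 : ℝ) * (ENNReal.ofReal V) ^ (1 / 2 : ℝ)) +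
        c₂ * ((ENNReal.ofReal (32 * M * K)) ^ (1 / 2 : ℝ) * (ENNReal.ofReal D) ^ (1 / 2 : ℝ)) := by
    refine h2.trans (h3'.trans ?_)
    refine add_le_add (mul_le_mul' le_rfl ?_) (mul_le_mul' le_rfl ?_)
    · exact hCS1.trans (mul_le_mul' (ENNReal.rpow_le_rpow h6i (by norm_num))
        (ENNReal.rpow_le_rpow h6ii.le (by norm_num)))
    · exact hCS2.trans (mul_le_mul' (ENNReal.rpow_le_rpow h6iv' (by norm_num))
        (ENNReal.rpow_le_rpow h6iii.le (by norm_num)))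
  have hfin' : ‖∫ x in A, w (x 2) * (v x) 2‖ₑ ≤ ENNReal.ofReal
      ((Real.sqrt (4 * π * b ^ 2))⁻¹ * (Real.sqrt (2 * π * M) * Real.sqrt V) +
        Real.sqrt C₂ * (Real.sqrt (32 * M * K) * Real.sqrt D)) := by
    refine hfin.trans (le_of_eq ?_)
    rw [hc₁, hc₂, ← ofReal_sqrt_eq_rpow_half (by positivity), ← ofReal_sqrt_eq_rpow_half hV0,
      ← ofReal_sqrt_eq_rpow_half (by positivity), ← ofReal_sqrt_eq_rpow_half hD0,
      ← ENNReal.ofReal_mul (Real.sqrt_nonneg _), ← ENNReal.ofReal_mul (Real.sqrt_nonneg _),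
      ← ENNReal.ofReal_mul (inv_nonneg.2 (Real.sqrt_nonneg _)), ← ENNReal.ofReal_mul (Real.sqrt_nonneg _),
      ← ENNReal.ofReal_add (by positivity) (by positivity)]
  rw [Real.enorm_eq_ofReal_abs, ENNReal.ofReal_le_ofReal_iff (by positivity)] at hfin'
  refine hfin'.trans ?_
  have e1 : (Real.sqrt (4 * π * b ^ 2))⁻¹ * Real.sqrt (2 * π * M) = Real.sqrt (M / (2 * b ^ 2)) := by
    rw [← Real.sqrt_inv, ← Real.sqrt_mul (inv_nonneg.2 (by positivity))]
    congr 1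
    field_simp
    ring
  have e2 : Real.sqrt C₂ * Real.sqrt (32 * M * K) = Real.sqrt (32 * C₂) * Real.sqrt (M * K) := by
    rw [← Real.sqrt_mul hC₂.le, ← Real.sqrt_mul (by positivity)]
    congr 1
    ring
  have t1 : (Real.sqrt (4 * π * b ^ 2))⁻¹ * (Real.sqrt (2 * π * M) * Real.sqrt V) ≤
      max (Real.sqrt (32 * C₂)) 1 * Real.sqrt (M / b ^ 2) * Real.sqrt V := by
    rw [← mul_assoc, e1]
    have h1 : Real.sqrt (M / (2 * b ^ 2)) ≤ Real.sqrt (M / b ^ 2) :=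
      Real.sqrt_le_sqrt (div_le_div_of_nonneg_left hM0 (by positivity) (by nlinarith))
    have hC1 : 1 ≤ max (Real.sqrt (32 * C₂)) 1 := le_max_right _ _
    calc Real.sqrt (M / (2 * b ^ 2)) * Real.sqrt V ≤ Real.sqrt (M / b ^ 2) * Real.sqrt V := by gcongr
      _ = 1 * Real.sqrt (M / b ^ 2) * Real.sqrt V := by ring
      _ ≤ max (Real.sqrt (32 * C₂)) 1 * Real.sqrt (M / b ^ 2) * Real.sqrt V := by gcongr
  have t2 : Real.sqrt C₂ * (Real.sqrt (32 * M * K) * Real.sqrt D) ≤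
      max (Real.sqrt (32 * C₂)) 1 * Real.sqrt D * Real.sqrt (M * K) := by
    rw [← mul_assoc, e2]
    calc Real.sqrt (32 * C₂) * Real.sqrt (M * K) * Real.sqrt D
        = Real.sqrt (32 * C₂) * Real.sqrt D * Real.sqrt (M * K) := by ring
      _ ≤ max (Real.sqrt (32 * C₂)) 1 * Real.sqrt D * Real.sqrt (M * K) := by
          gcongr
          exact le_max_left _ _
  linarith [t1, t2]

end Main

end Summit.NavierStokesRegularity.NavierStokesRegularity.Theorems.PowerGaugeEulerLiouville.CasimirHaul

end
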